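import Literature.Probability.RandomPlanarGeometry.StarShiftSubordination
import Literature.Probability.RandomPlanarGeometry.StarShiftThinHull
import Literature.Probability.RandomPlanarGeometry.RestrictionOuterHulls
import HarnessLib

/-!
# Outer continuity of the hydrodynamic constant `L` and its continuity along dyadic outer hulls

G. F. Lawler, O. Schramm, W. Werner, *Conformal restriction: the chordal case*, J. Amer. Math.
Soc. **16** (2003), §5: the image driving function of the locality/restriction argument is
`W̃_t = W_t + L_A − L_{B_t}`, `L_B = starShift B` the constant term of the reflected canonical map
`E_B(z) = z + L_B + o(1)` (`StarHullCanonical.lean`). To see that `ω ↦ L_{B_t(ω)}` is a random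
variable one approximates the `*`-hull `B` from OUTSIDE by the dyadic outer hulls
`outerHull n (outerConfig b n)` of `RestrictionOuterHulls.lean` (functions of countably many
conditions on a dense sequence `b` of `B`) and needs **`L_{outerHull_n} → L_B`**
(`tendsto_starShift_outerHull`), the `L`-analogue of `tendsto_starDeriv_outerHull`.

Proof. For `*`-hulls `B ⊆ H`, `L_H = L_B + L_Q` with the quotient hull
`Q = cl Φ_B((H ∖ B) ∩ ℍ)` (`starShift_eq_add_starShift_quotientHull`, `StarShiftSubordination.lean`).
If moreover `H ⊆ thickHull B δ` with `δ` small, `Q` lies in a thin double box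
`{c ≤ |Re w| ≤ M, Im w ≤ θ}` (`IsStarHull.exists_forall_quotientHull_subset_thin`: the first half of
the proof of `HasRestrictionDeriv.exists_forall_outer_ge` of `RestrictionDerivOuter.lean` —
`Φ_B` is bounded and bounded away from `0` on the relevant annulus, and `im Φ_B` is small
throughout a thin fill, `IsRestrictionMap.im_le_of_mem_thickHull`), and thin `*`-hulls have small
`L` (`exists_forall_abs_starShift_le_of_thin`, `StarShiftThinHull.lean`). This gives the outer
continuity `‖L_H − L_B‖ ≤ ε` (`IsStarHull.exists_forall_norm_starShift_sub_le`), and the dyadic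
outer hulls are eventually `*`-hulls between `B` and `thickHull B (4/2ⁿ)` (`isStarHull_outerHull`).

## References

* G. F. Lawler, O. Schramm, W. Werner, *Conformal restriction: the chordal case* (2003), §2 p. 8
  (Semigroups, Fillings), §5 [LawlerSchrammWerner2003Restriction].
* G. F. Lawler, *Conformally Invariant Processes in the Plane*, AMS (2005), §3.4, §4.6.1
  [Lawler2005].
-/

noncomputable section

open Set Filter Metric Function Bornology
open _root_.Complex _root_.Topology
open UpperHalfPlane (upperHalfPlaneSet)
open scoped NNReal

namespace Literature.Probability.RandomPlanarGeometry

variable {B : Set ℂ} {b : ℕ → ℂ}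

/-! ### Quotient hulls of thin outer hulls are thin -/

/-- The thin double box `{c ≤ |Re w| ≤ M, Im w ≤ θ}` is closed. [folklore] -/
theorem isClosed_setOf_thinBox (c M θ : ℝ) :
    IsClosed {w : ℂ | c ≤ |w.re| ∧ |w.re| ≤ M ∧ w.im ≤ θ} := by
  have h : Continuous fun w : ℂ ↦ |w.re| := continuous_abs.comp continuous_re
  exact (isClosed_le continuous_const h).and
    ((isClosed_le h continuous_const).and (isClosed_le continuous_im continuous_const))

/-- **Quotient hulls of hulls close to `B` from outside lie in thin double boxes**: for a nonempty
`*`-hull `B` there are `0 < c ≤ M` such that for every `θ > 0` there is `δ > 0` with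
`cl Φ_B((H ∖ B) ∩ ℍ) ⊆ {c ≤ |Re w| ≤ M, Im w ≤ θ}` for every `*`-hull `H` with
`B ⊆ H ⊆ thickHull B δ`. Points of `(H ∖ B) ∩ ℍ` are far from `0` (thin fills keep a ball about
`0` free, `exists_forall_zero_notMem_thickHull`) and bounded, so `c₀ ≤ ‖Φ_B‖ ≤ M` there
(`IsRestrictionMap.exists_le_norm`, `IsRestrictionMap.exists_norm_le`), and `im Φ_B ≤ θ`
throughout the thin fill (`IsRestrictionMap.im_le_of_mem_thickHull`); with `θ ≤ c₀/4` this forces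
`|Re Φ_B| ≥ c₀/2`.
[cite: LawlerSchrammWerner2003Restriction, §2 p. 8 (Semigroups, Fillings)] -/
theorem IsStarHull.exists_forall_quotientHull_subset_thin (hB : IsStarHull B) (hne : B.Nonempty) :
    ∃ c M : ℝ, 0 < c ∧ c ≤ M ∧ ∀ θ : ℝ, 0 < θ → ∃ δ > 0, ∀ {H : Set ℂ}, IsStarHull H → B ⊆ H →
      H ⊆ thickHull B δ →
        quotientHull H B (starRMap B hB) ⊆ {w : ℂ | c ≤ |w.re| ∧ |w.re| ≤ M ∧ w.im ≤ θ} := by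
  classical
  set Φ₀ := starRMap B hB with hΦ₀def
  have hΦ₀ : IsRestrictionMap B Φ₀ := isRestrictionMap_starRMap hB
  -- geometry of the thickened hulls: a radius `r₁` kept free near `0`, an outer radius `R₁`
  obtain ⟨s₀, hs₀, hs₀F⟩ := exists_forall_zero_notMem_thickHull hB
  set δ₀ : ℝ := s₀ / 2 with hδ₀
  have hδ₀0 : 0 < δ₀ := by positivity
  have h0F : (0 : ℂ) ∉ thickHull B δ₀ := hs₀F δ₀ hδ₀0.le (by rw [hδ₀]; linarith)
  obtain ⟨r₁, hr₁, hr₁F⟩ : ∃ r₁ > 0, ball (0 : ℂ) r₁ ⊆ (thickHull B δ₀)ᶜ :=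
    Metric.isOpen_iff.1 (isClosed_thickHull B δ₀).isOpen_compl 0 h0F
  obtain ⟨R₁, hR₁⟩ := (isBounded_hpFill (isBounded_nbhdSet hB.isBoundedHull.1 1) :
    IsBounded (thickHull B 1)).subset_closedBall 0
  -- bounds for `Φ₀`
  obtain ⟨M, -, hM⟩ := hΦ₀.exists_norm_le hB R₁
  obtain ⟨c₀, hc₀, hc₀le⟩ := hΦ₀.exists_le_norm hB hr₁
  refine ⟨c₀ / 2, max M (c₀ / 2), by positivity, le_max_right _ _, fun θ' hθ' ↦ ?_⟩
  -- the height: at most `θ'` and at most `c₀ / 4`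
  set θ : ℝ := min θ' (c₀ / 4) with hθ
  have hθ0 : 0 < θ := lt_min hθ' (by positivity)
  obtain ⟨δ₁, hδ₁, hδ₁im⟩ := hΦ₀.exists_forall_im_lt_of_infDist_le hB hne hθ0
  set δ : ℝ := min δ₁ (min δ₀ 1) with hδ
  have hδ0 : 0 < δ := lt_min hδ₁ (lt_min hδ₀0 one_pos)
  have hδδ₁ : δ ≤ δ₁ := min_le_left _ _
  have hδδ₀ : δ ≤ δ₀ := (min_le_right _ _).trans (min_le_left _ _)
  have hδ1 : δ ≤ 1 := (min_le_right _ _).trans (min_le_right _ _)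
  refine ⟨δ, hδ0, fun {H} hH hsub hHF ↦ ?_⟩
  have himage : Φ₀ '' ((H \ B) ∩ upperHalfPlaneSet) ⊆
      {w : ℂ | c₀ / 2 ≤ |w.re| ∧ |w.re| ≤ max M (c₀ / 2) ∧ w.im ≤ θ'} := by
    rintro _ ⟨z, ⟨⟨hzH, hzB⟩, hz⟩, rfl⟩
    have hzF : z ∈ thickHull B δ := hHF hzH
    -- `z` is far from `0` (the fill of the `δ₀`-neighbourhood misses `B(0, r₁)`), not too far out
    have hzr : r₁ ≤ ‖z‖ := by
      by_contra hlt
      push Not at hlt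
      exact hr₁F (mem_ball_zero_iff.2 hlt) (thickHull_mono B hδδ₀ hzF)
    have hzR : ‖z‖ ≤ R₁ := by
      have := hR₁ (thickHull_mono B hδ1 hzF)
      rwa [mem_closedBall, dist_zero_right] at this
    have hw_im : (Φ₀ z).im ≤ θ :=
      hΦ₀.im_le_of_mem_thickHull hB hθ0 hδ₁ hδ₁im hδ0.le hδδ₁ ⟨hz, hzB⟩ hzF
    have hw_lo : c₀ ≤ ‖Φ₀ z‖ := hc₀le z ⟨hz, hzB⟩ hzr
    have hw_hi : ‖Φ₀ z‖ ≤ M := hM z ⟨hz, hzB⟩ hzR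
    have hw_im0 : 0 < (Φ₀ z).im := Φ₀.mapsTo ⟨hz, hzB⟩
    have hθc : θ ≤ c₀ / 4 := min_le_right _ _
    -- `|re| ≥ c₀/2` since `‖w‖ ≥ c₀` and `0 < im w ≤ θ ≤ c₀/4`
    have hre : c₀ / 2 ≤ |(Φ₀ z).re| := by
      have h1 : c₀ ^ 2 ≤ (Φ₀ z).re ^ 2 + (Φ₀ z).im ^ 2 := by
        have := Complex.sq_norm (Φ₀ z)
        rw [Complex.normSq_apply] at this
        nlinarith
      have h2 : (Φ₀ z).im ^ 2 ≤ (c₀ / 4) ^ 2 := by nlinarith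
      have h3 : (c₀ / 2) ^ 2 ≤ (Φ₀ z).re ^ 2 := by nlinarith
      nlinarith [sq_abs (Φ₀ z).re, abs_nonneg (Φ₀ z).re]
    have hreM : |(Φ₀ z).re| ≤ M := (abs_re_le_norm _).trans hw_hi
    exact ⟨hre, hreM.trans (le_max_left _ _), hw_im.trans (min_le_left _ _)⟩
  exact closure_minimal himage (isClosed_setOf_thinBox _ _ _)

/-! ### Outer continuity of `L` -/

/-- **Outer continuity of the hydrodynamic constant `L`.** For a nonempty `*`-hull `B` and
`ε > 0` there is `δ > 0` such that every `*`-hull `H` with `B ⊆ H ⊆ thickHull B δ` has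
`‖L_H − L_B‖ ≤ ε`: `L_H − L_B = L_Q` for the quotient hull `Q` of the canonical map
(`starShift_eq_add_starShift_quotientHull`), which is a thin `*`-hull
(`isStarHull_quotientHull_starRMap`, `IsStarHull.exists_forall_quotientHull_subset_thin`), hence
has small `L` (`exists_forall_abs_starShift_le_of_thin`).
[cite: LawlerSchrammWerner2003Restriction, §5 (W̃_t = W_t + L_A − L_{B_t}) with §2 p. 8 (Semigroups)] -/
theorem IsStarHull.exists_forall_norm_starShift_sub_le (hB : IsStarHull B) (hne : B.Nonempty)
    {ε : ℝ} (hε : 0 < ε) :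
    ∃ δ > 0, ∀ {H : Set ℂ}, IsStarHull H → B ⊆ H → H ⊆ thickHull B δ →
      ‖starShift H - starShift B‖ ≤ ε := by
  obtain ⟨c, M, hc, hcM, hbox⟩ := hB.exists_forall_quotientHull_subset_thin hne
  obtain ⟨θ, hθ, hthin⟩ := exists_forall_abs_starShift_le_of_thin hc hcM hε
  obtain ⟨δ, hδ, hδbox⟩ := hbox θ hθ
  refine ⟨δ, hδ, fun {H} hH hsub hHF ↦ ?_⟩
  rw [starShift_eq_add_starShift_quotientHull hH hB hsub, add_sub_cancel_left]
  exact hthin _ (isStarHull_quotientHull_starRMap hH hB hsub) (hδbox hH hsub hHF)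

/-! ### `L_{outerHull_n} → L_B` -/

/-- The mesh `4 / 2ⁿ` of the dyadic outer hulls tends to `0`. [folklore] -/
theorem tendsto_four_div_two_pow : Tendsto (fun n : ℕ ↦ (4 : ℝ) / 2 ^ n) atTop (𝓝 0) := by
  have := (tendsto_pow_atTop_nhds_zero_of_lt_one (r := (1 / 2 : ℝ)) (by norm_num)
    (by norm_num)).const_mul (4 : ℝ)
  rw [mul_zero] at this
  refine this.congr fun n ↦ ?_
  rw [one_div, inv_pow, div_eq_mul_inv]

/-- **Continuity of `L` along the dyadic outer hulls**: for a nonempty `*`-hull `B` and a sequence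
`b` of points of `B` dense in `B`, `starShift (outerHull n (outerConfig b n)) → starShift B`
(the outer hulls are eventually `*`-hulls with `B ⊆ outerHull_n ⊆ thickHull B (4/2ⁿ)`,
`isStarHull_outerHull`, and `L` is outer continuous,
`IsStarHull.exists_forall_norm_starShift_sub_le`). The `L`-analogue of
`tendsto_starDeriv_outerHull`, used for the measurability of `ω ↦ L_{B_t(ω)}` in the image
driving function `W̃_t = W_t + L_A − L_{B_t}`.
[cite: LawlerSchrammWerner2003Restriction, §5 (W̃_t = W_t + L_A − L_{B_t}) with §2 p. 8 (Fillings)] -/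
theorem tendsto_starShift_outerHull (hB : IsStarHull B) (hne : B.Nonempty) (hb : ∀ k, b k ∈ B)
    (hdense : B ⊆ closure (range b)) :
    Tendsto (fun n ↦ starShift (outerHull n (outerConfig b n))) atTop (𝓝 (starShift B)) := by
  rw [Metric.tendsto_atTop]
  intro ε hε
  obtain ⟨δ, hδ, hout⟩ := hB.exists_forall_norm_starShift_sub_le hne (half_pos hε)
  have hsmall : ∀ᶠ n : ℕ in atTop, (4 : ℝ) / 2 ^ n ≤ δ :=
    tendsto_four_div_two_pow.eventually (ge_mem_nhds hδ)
  obtain ⟨N, hN⟩ := (hsmall.and (isStarHull_outerHull hB hb hdense)).exists_forall_of_atTop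
  refine ⟨N, fun n hn ↦ ?_⟩
  obtain ⟨hδn, hstar, hBsub, hthick⟩ := hN n hn
  have hHsub : outerHull n (outerConfig b n) ⊆ thickHull B δ :=
    hthick.trans (thickHull_mono _ hδn)
  rw [dist_eq_norm]
  exact (hout hstar hBsub hHsub).trans_lt (half_lt_self hε)

end Literature.Probability.RandomPlanarGeometry
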